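import Literature.AlgebraicGeometry.Frobenioids.DivisorMonoidCategoryTheoreticityCorProofsV
import HarnessLib

/-!
# Frobenioids I, Corollary 4.11 (iv), rigidity clause AS TYPED (`PreFrobenioidData.Cor411ivRigid`) — for
# EVERY base square datum and EVERY `Ψ^Φ`-candidate, NO residual hypothesis (FACT-LIST row F-1030)

Mochizuki, *The geometry of Frobenioids I: the general theory*, Kyushu J. Math. **62** (2008)
293–400, kurims text: Cor. 4.11 (iv) p. 92 "Moreover, each of the composite functors of this diagram is
rigid"; proof p. 94 "The fact that the composite functors in this diagram are rigid follows via the same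
argument as the argument applied to prove rigidity in the proof of assertion (i)", i.e. the Div-slimness
argument of p. 93 [cite: MochizukiFrdI2008, Cor. 4.11 (iv) p.92].

PROOF-ONLY companion of `DivisorMonoidCategoryTheoreticity.lean` (seat abc-iut-f-033; FACT-LIST row F-1030
`PreFrobenioidData.Cor411ivRigid`, [FrdI] Corollary 4.11 (iv) p. 92). The typed rigidity clause is a schema
over the data `(Ψ^Base, Ψ^Φ)` of the `1`-commutative diagram of (iv). Seat abc-iut-L1-d6's
`PreFrobenioid.cor411ivRigid_of_square` proves it for data satisfying the Div-formula
`Div(Ψ φ) = η_A^* Ψ^Φ(Div φ)`. Here the Div-formula hypothesis is REMOVED: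

* `PreFrobenioid.cor411ivRigid_of_baseIso` — for Frobenioids `C_i → F_{Φ_i}`, ANY functor
  `Ψ^Base : D₁ → D₂` under `Ψ` (i.e. with some `η : Base₂ ∘ Ψ ≅ Ψ^Base ∘ Base₁`) and ANY family of monoid
  isomorphisms `E : Φ₁ ⥲ Φ₂ ∘ Ψ^Base` natural in pull-backs, the typed `Cor411ivRigid` holds. First clause
  (`Base₂ ∘ Ψ` is Div-rigid): `PreFrobenioid.comp_baseFunctor_iso_eq_refl_of_isDivSlim` (seat abc-iut-L1-t10,
  the p. 93 argument over the Div-slim base `D₂`). Second clause (`Ψ^Base ∘ Base₁`): an automorphism `α`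
  whose components fix the `E`-images of the divisors of all arrows out of each `A` fixes ALL of
  `Φ₂(Ψ^Base(Base A))` — every element of `Φ₁(Base A)` is a `Div(φ)`, `φ` out of `A` (Def. 1.3 (iii)(d)),
  and `E_{Base A}` is onto — so its conjugate `η α η⁻¹`, an automorphism of `Base₂ ∘ Ψ`, fixes everything and
  is trivial by the first clause;
* `PreFrobenioid.cor411ivRigid_holds_of_oneCommutes` — **the instance form AT THE DATA of Cor. 4.11**: for
  every `Ψ^Base` making the square of Cor. 4.11 (ii) `1`-commute (THE `Ψ^Base`, in each of its `1`-unique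
  choices) and every `Ψ^Φ`-candidate `E` over it, `Cor411ivRigid` holds — hypotheses: `C_i → F_{Φ_i}`
  Frobenioids, nothing else (Div-slimness of `D₂` is part of the typed antecedent `Cor411Setting`).

The universal closure of the schema in a BARE functor `Ψ^Base` (no square) is not what print asserts and is
not claimed. No new definitions; no statement of the paper is restated or strengthened; nothing here is
specific to the abc programme and no side is taken on [IUTchIII] Cor. 3.12.
-/

namespace Literature.AlgebraicGeometry.Frobenioids

open CategoryTheory Opposite

universe w v v' u u'

namespace PreFrobenioid

variable {D₁ : Type u} [Category.{v} D₁] {Φ₁ : D₁ᵒᵖ ⥤ CommMonCat.{w}}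
  {C₁ : Type u'} [Category.{v'} C₁] {F₁ : C₁ ⥤ ElemFrobenioid Φ₁}
  {D₂ : Type u} [Category.{v} D₂] {Φ₂ : D₂ᵒᵖ ⥤ CommMonCat.{w}}
  {C₂ : Type u'} [Category.{v'} C₂] {F₂ : C₂ ⥤ ElemFrobenioid Φ₂}

set_option backward.isDefEq.respectTransparency false in
/-- **[FrdI] Cor. 4.11 (iv), rigidity clause (typed `Cor411ivRigid`) for EVERY `Ψ^Base` under `Ψ` and EVERY
`Ψ^Φ`-candidate** ("each of the composite functors of this diagram is rigid", p. 92; "via the same argument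
as … (i)", p. 94): for Frobenioids `C_i → F_{Φ_i}`, an equivalence `Ψ : C₁ ⥲ C₂`, a functor `Ψ^Base` with
`η : Base₂ ∘ Ψ ≅ Ψ^Base ∘ Base₁`, and monoid isomorphisms `E_X : Φ₁(X) ⥲ Φ₂(Ψ^Base X)` natural in pull-backs,
under `Cor411Setting` (Div-slim `D₂`): an automorphism of `Base₂ ∘ Ψ` fixing the divisors of all `Ψ φ` is
trivial (seat abc-iut-L1-t10's `comp_baseFunctor_iso_eq_refl_of_isDivSlim`), and an automorphism `α` of
`Ψ^Base ∘ Base₁` fixing all `E(Div φ)` is trivial: by Def. 1.3 (iii)(d) (every `x ∈ Φ₁(Base A)` is a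
`Div φ`) and the surjectivity of `E`, each `α_A` acts trivially on `Φ₂`, hence so does `η α η⁻¹`, which is
then trivial by the first clause. No Div-formula for `E` is needed (cf. `cor411ivRigid_of_square`).
[cite: MochizukiFrdI2008, Cor. 4.11 (iv) p.94] -/
theorem cor411ivRigid_of_baseIso (hF₁ : IsFrobenioid F₁) (hF₂ : IsFrobenioid F₂) (Ψ : C₁ ≌ C₂)
    (ΨBase : D₁ ⥤ D₂)
    (η : Ψ.functor ⋙ (PreFrobenioidData.ofFunctor Φ₂ F₂).base ≅ (PreFrobenioidData.ofFunctor Φ₁ F₁).base ⋙ ΨBase)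
    (E : (PreFrobenioidData.ofFunctor Φ₁ F₁).DivisorMonoidIsoOverBase (PreFrobenioidData.ofFunctor Φ₂ F₂) ΨBase) :
    (PreFrobenioidData.ofFunctor Φ₁ F₁).Cor411ivRigid (PreFrobenioidData.ofFunctor Φ₂ F₂) Ψ ΨBase E := by
  intro hs
  have hds : (PreFrobenioidData.ofFunctor Φ₂ F₂).IsDivSlim := hs.divSlim.2
  have h1 : ∀ α : Ψ.functor ⋙ (PreFrobenioidData.ofFunctor Φ₂ F₂).base ≅ Ψ.functor ⋙ (PreFrobenioidData.ofFunctor Φ₂ F₂).base,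
      (∀ ⦃A B : C₁⦄ (φ : A ⟶ B), (PreFrobenioidData.ofFunctor Φ₂ F₂).pull (α.hom.app A)
          ((PreFrobenioidData.ofFunctor Φ₂ F₂).div (Ψ.functor.map φ)) =
            (PreFrobenioidData.ofFunctor Φ₂ F₂).div (Ψ.functor.map φ)) →
        α = Iso.refl _ :=
    fun α hα => comp_baseFunctor_iso_eq_refl_of_isDivSlim Ψ hF₂ hds α hα
  refine ⟨h1, fun α hα => ?_⟩
  -- each `α_A` acts trivially on `Φ₂(Ψ^Base (Base A))`: Def. 1.3 (iii)(d) for `C₁` and `E` onto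
  have hfix : ∀ (A : C₁)
      (y : (PreFrobenioidData.ofFunctor Φ₂ F₂).Mon (((PreFrobenioidData.ofFunctor Φ₁ F₁).base ⋙ ΨBase).obj A)),
      (PreFrobenioidData.ofFunctor Φ₂ F₂).pull (α.hom.app A) y = y := by
    intro A y
    obtain ⟨x, rfl⟩ := (E.iso ((PreFrobenioidData.ofFunctor Φ₁ F₁).base.obj A)).surjective y
    obtain ⟨B, φ, -, hφ⟩ := hF₁.iii_d_under_surj A x
    rw [← hφ]
    exact hα φ
  -- transport `α` along `η` to an automorphism of `Base₂ ∘ Ψ` fixing everything, in particular divisors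
  have h2 : η ≪≫ α ≪≫ η.symm = Iso.refl _ := by
    refine h1 (η ≪≫ α ≪≫ η.symm) fun A B φ => ?_
    rw [Iso.trans_hom, Iso.trans_hom, NatTrans.comp_app, NatTrans.comp_app, Iso.symm_hom,
      (PreFrobenioidData.ofFunctor Φ₂ F₂).pull_comp, (PreFrobenioidData.ofFunctor Φ₂ F₂).pull_comp, hfix,
      ← (PreFrobenioidData.ofFunctor Φ₂ F₂).pull_comp, Iso.hom_inv_id_app,
      (PreFrobenioidData.ofFunctor Φ₂ F₂).pull_id]
  calc α = η.symm ≪≫ (η ≪≫ α ≪≫ η.symm) ≪≫ η := by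
        ext X
        simp
    _ = Iso.refl _ := by
        rw [h2]
        ext X
        simp

/-- **[FrdI] Corollary 4.11 (iv), rigidity clause — FACT-LIST row F-1030 `PreFrobenioidData.Cor411ivRigid`,
the instance form AT THE DATA of Cor. 4.11, NO residual hypothesis** (p. 92 "Moreover, each of the composite
functors [`C₁ → F_{Φ₂}`] of this diagram is rigid"): for Frobenioids `C_i → F_{Φ_i}` (Def. 1.3) and an
equivalence `Ψ : C₁ ⥲ C₂`, for EVERY functor `Ψ^Base : D₁ → D₂` making the square of Cor. 4.11 (ii)
`1`-commute (`Base₂ ∘ Ψ ≅ Ψ^Base ∘ Base₁` — THE `Ψ^Base`, in any of its `1`-unique choices) and EVERY family of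
monoid isomorphisms `Ψ^Φ : Φ₁ ⥲ Φ₂ ∘ Ψ^Base` natural in pull-backs (in particular THE `Ψ^Φ` of (iii)/(iv)),
the typed `Cor411ivRigid` holds: under `Cor411Setting`, every automorphism of `Base₂ ∘ Ψ`, resp. of
`Ψ^Base ∘ Base₁`, whose components fix the divisors `Div(Ψ φ)`, resp. `Ψ^Φ(Div φ)`, of all arrows `φ` is the
identity. [cite: MochizukiFrdI2008, Cor. 4.11 (iv) p.92] -/
theorem cor411ivRigid_holds_of_oneCommutes (hF₁ : IsFrobenioid F₁) (hF₂ : IsFrobenioid F₂) (Ψ : C₁ ≌ C₂)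
    (ΨBase : D₁ ⥤ D₂)
    (hΨBase : OneCommutes Ψ.functor (PreFrobenioidData.ofFunctor Φ₂ F₂).base
      (PreFrobenioidData.ofFunctor Φ₁ F₁).base ΨBase)
    (E : (PreFrobenioidData.ofFunctor Φ₁ F₁).DivisorMonoidIsoOverBase (PreFrobenioidData.ofFunctor Φ₂ F₂) ΨBase) :
    (PreFrobenioidData.ofFunctor Φ₁ F₁).Cor411ivRigid (PreFrobenioidData.ofFunctor Φ₂ F₂) Ψ ΨBase E := by
  obtain ⟨η⟩ := hΨBase
  exact cor411ivRigid_of_baseIso hF₁ hF₂ Ψ ΨBase η E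

end PreFrobenioid

end Literature.AlgebraicGeometry.Frobenioids
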